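import Literature.Topology.FourManifolds.MMSWTwistedPictureVelocity
import Literature.Topology.FourManifolds.CircleAngleLift
import HarnessLib

/-!
# Uniform constants of a picture in general position with generic bands

Sibling of `MMSWTwistedPictureVelocity.lean`, towards the transversality of the new double
points of the twisted pictures `D(0⃗)(stripTwistAt_k ∘ K)` for LARGE `k` and the named fact
`Literature.Topology.FourManifolds.MMSW.eventually_approxHasRasmussen` (Manolescu–Marengon–
Sarkar–Willis, arXiv:1910.08195, Thm. 1.4 / Prop. 8.2 (i); §8.1 in the tree's picture).
Compactness of the period window turns the pointwise genericity hypotheses into the three uniform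
constants the counting argument (`SmoothTransitionFlatEnds.smoothTransition_fast_or_flat`)
consumes (`c = chartC ∘ K₃.stereoCurve`, `f = Re z` along the knot, `W_j` the closed windows):

* `exists_bounds_norm_chartC` — `0 < ρ_min ≤ |c| ≤ ρ_max`;
* `exists_bound_angular` — `|Im (conj c · c')| ≤ M₀ |f'|` wherever `f ∈ ⋃ W_j` (no critical
  value of `f` in the windows);
* `exists_lowerBound_dist_upper_lower` — `‖c s - c t‖ ≥ δ₀ > 0` whenever `f s = f t ∈ W_j` with
  `s` upper (`Im z > 0`) and `t` lower (crossing values off the windows: such a pair is never an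
  old double point, and never the same point of the knot).

Everything is proved; no definitions, no named facts.

## References

* C. Manolescu, M. Marengon, S. Sarkar, M. Willis, Duke Math. J. 172 (2023), arXiv:1910.08195,
  §8.1. [ManolescuMarengonSarkarWillis2023]
-/

open scoped Manifold ContDiff Topology ComplexConjugate
open Function Set Filter Complex

noncomputable section

namespace Literature.Topology.FourManifolds

/-- Local notation: `𝔼 n` is the model Euclidean space `EuclideanSpace ℝ (Fin n)`. -/
local notation "𝔼 " n:arg => EuclideanSpace ℝ (Fin n)

/-- Local notation: `𝕊 n` is the unit sphere in `EuclideanSpace ℝ (Fin (n + 1))`. -/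
local notation "𝕊 " n:arg => (Metric.sphere (0 : EuclideanSpace ℝ (Fin (n + 1))) 1)

namespace MMSW

open Literature.AlgebraicTopology.Homotopy.HopfFibration (zC wC ofZW zC_ofZW wC_ofZW ofZW_zC_wC)

variable {r : ℕ}

/-! ## Periodic continuous functions: bounds over one period -/

/-- A continuous periodic function attains all its values on one closed period. [folklore] -/
theorem exists_mem_Icc_eq_of_periodic {g : ℝ → ℝ} {T : ℝ} (hper : Periodic g T) (hT : 0 < T)
    (θ : ℝ) : ∃ y ∈ Icc 0 T, g θ = g y := by
  obtain ⟨y, hy, hgy⟩ := hper.exists_mem_Ico₀ hT θ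
  exact ⟨y, Ico_subset_Icc_self hy, hgy⟩

/-- **A continuous positive periodic function is bounded below by a positive constant and
bounded above.** [folklore] -/
theorem exists_pos_bounds_of_periodic {g : ℝ → ℝ} {T : ℝ} (hg : Continuous g) (hper : Periodic g T)
    (hT : 0 < T) (hpos : ∀ θ, 0 < g θ) : ∃ m M : ℝ, 0 < m ∧ ∀ θ, m ≤ g θ ∧ g θ ≤ M := by
  have hne : (Icc (0 : ℝ) T).Nonempty := nonempty_Icc.2 hT.le
  obtain ⟨y₀, -, hmin⟩ := isCompact_Icc.exists_isMinOn hne hg.continuousOn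
  obtain ⟨y₁, -, hmax⟩ := isCompact_Icc.exists_isMaxOn hne hg.continuousOn
  refine ⟨g y₀, g y₁, hpos y₀, fun θ ↦ ?_⟩
  obtain ⟨y, hy, hgy⟩ := exists_mem_Icc_eq_of_periodic hper hT θ
  rw [hgy]
  exact ⟨hmin hy, hmax hy⟩

/-! ## The radius of the picture is bounded above and below -/

/-- **`0 < ρ_min ≤ |c| ≤ ρ_max`** for the complex planar coordinate of the picture of a
core-missing model knot. [folklore] -/
theorem exists_bounds_norm_chartC {K : 𝕊 1 → 𝔼 4} (hK : IsModelKnot r K) (hw : ∀ t, wC (K t) ≠ 0)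
    {K₃ : Knot} (hK₃ : ⇑K₃ = finiteApprox r 0 K) :
    ∃ ρmin ρmax : ℝ, 0 < ρmin ∧ ∀ θ, ρmin ≤ ‖chartC (K₃.stereoCurve θ)‖ ∧
      ‖chartC (K₃.stereoCurve θ)‖ ≤ ρmax := by
  have heq : ∀ θ, ‖chartC (K₃.stereoCurve θ)‖ = (zC (K (circlePoint θ))).re + drawRadius r :=
    norm_chartC_stereoCurve hK hw hK₃
  have hg : Continuous fun θ : ℝ ↦ (zC (K (circlePoint θ))).re + drawRadius r :=
    (continuous_re_zC_comp hK).add continuous_const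
  have hper : Periodic (fun θ : ℝ ↦ (zC (K (circlePoint θ))).re + drawRadius r) (2 * Real.pi) :=
    fun θ ↦ by simp only [periodic_circlePoint θ]
  obtain ⟨m, M, hm, hb⟩ := exists_pos_bounds_of_periodic hg hper Real.two_pi_pos
    fun θ ↦ re_zC_add_drawRadius_pos (hK.mem _)
  exact ⟨m, M, hm, fun θ ↦ by rw [heq]; exact hb θ⟩

/-! ## The angular velocity is dominated by the radial one on the windows -/

/-- Reduction of a parameter into the period window, with the values of finitely many
`2π`-periodic functions preserved. [folklore] -/
theorem exists_mem_Icc_two_pi (θ : ℝ) : ∃ (n : ℤ) (y : ℝ), y ∈ Icc 0 (2 * Real.pi) ∧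
    y = θ - n • (2 * Real.pi) := by
  refine ⟨toIcoDiv Real.two_pi_pos 0 θ, toIcoMod Real.two_pi_pos 0 θ, ?_, ?_⟩
  · have h1 := toIcoMod_mem_Ico Real.two_pi_pos 0 θ
    rw [zero_add] at h1
    exact Ico_subset_Icc_self h1
  · rw [← self_sub_toIcoDiv_zsmul]

/-- The derivative of a periodic function is periodic. [folklore] -/
theorem periodic_deriv {g : ℝ → ℝ × ℝ} {T : ℝ} (hper : Periodic g T) : Periodic (deriv g) T :=
  fun θ ↦ by
    rw [← deriv_comp_add_const]
    exact congrArg (fun h ↦ deriv h θ) (funext hper)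

/-- **On the closed windows the angular part of the velocity is dominated by the radial one**:
`|Im (conj c · c')| ≤ M₀ · |f'|` wherever `f = Re z` lies in a window containing no critical
value of `f`. [folklore] -/
theorem exists_bound_angular {K : 𝕊 1 → 𝔼 4} (hK : IsModelKnot r K) {K₃ : Knot}
    (hK₃ : ⇑K₃ = finiteApprox r 0 K) {w : ℝ} {e : Fin r → ℝ}
    (hcrit : ∀ (j : Fin r) (θ : ℝ), deriv (fun θ : ℝ ↦ (zC (K (circlePoint θ))).re) θ = 0 →
      (zC (K (circlePoint θ))).re ∉
        Icc ((holeCentre r j).re + e j - w) ((holeCentre r j).re + e j + w)) :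
    ∃ M₀ : ℝ, 0 ≤ M₀ ∧ ∀ θ : ℝ, (∃ j : Fin r, (zC (K (circlePoint θ))).re ∈
        Icc ((holeCentre r j).re + e j - w) ((holeCentre r j).re + e j + w)) →
      |(conj (chartC (K₃.stereoCurve θ)) * chartC (deriv K₃.planeCurve θ, 0)).im| ≤
        M₀ * |deriv (fun θ : ℝ ↦ (zC (K (circlePoint θ))).re) θ| := by
  set f : ℝ → ℝ := fun θ ↦ (zC (K (circlePoint θ))).re with hf
  set angv : ℝ → ℝ := fun θ ↦ (conj (chartC (K₃.stereoCurve θ)) * chartC (deriv K₃.planeCurve θ, 0)).im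
    with hangv
  have hne : ∀ x, K₃ x ≠ northPole := fun x ↦ ne_northPole_of_coe_eq_finiteApprox hK₃ x
  -- continuity
  have hfc : ContDiff ℝ ∞ f := by
    have hc : ContDiff ℝ ∞ fun θ : ℝ ↦ K (circlePoint θ) :=
      contMDiff_iff_contDiff.1 (hK.1.comp contMDiff_circlePoint)
    exact Complex.reCLM.contDiff.comp (contDiff_zC.comp hc)
  have hf'c : Continuous (deriv f) := hfc.continuous_deriv (by simp)
  have hcC : Continuous fun θ ↦ chartC (K₃.stereoCurve θ) := by
    have h := (Knot.contDiff_stereoCurve hne).continuous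
    have hch : Continuous chartC := by
      unfold chartC; fun_prop
    exact hch.comp h
  have hdc : Continuous fun θ ↦ chartC (deriv K₃.planeCurve θ, 0) := by
    have h := (Knot.contDiff_planeCurve hne).continuous_deriv (by simp)
    have hch : Continuous chartC := by
      unfold chartC; fun_prop
    exact hch.comp (h.prodMk continuous_const)
  have hangvc : Continuous angv := Complex.continuous_im.comp ((Complex.continuous_conj.comp hcC).mul hdc)
  -- periodicity
  have hfper : Periodic f (2 * Real.pi) := fun θ ↦ by simp only [hf, periodic_circlePoint θ]
  have hf'per : Periodic (deriv f) (2 * Real.pi) := AngleLift.deriv_periodic hfper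
  have hangvper : Periodic angv (2 * Real.pi) := fun θ ↦ by
    simp only [hangv, K₃.periodic_stereoCurve θ, periodic_deriv K₃.periodic_planeCurve θ]
  -- the compact window region in one period
  set A : Set ℝ := {θ | θ ∈ Icc 0 (2 * Real.pi) ∧ ∃ j : Fin r,
    f θ ∈ Icc ((holeCentre r j).re + e j - w) ((holeCentre r j).re + e j + w)} with hA
  have hAc : IsCompact A := by
    refine isCompact_Icc.of_isClosed_subset ?_ fun θ hθ ↦ hθ.1
    rw [hA, setOf_and]
    refine isClosed_Icc.inter ?_
    have : {a : ℝ | ∃ j : Fin r, f a ∈ Icc ((holeCentre r j).re + e j - w) ((holeCentre r j).re + e j + w)}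
        = ⋃ j : Fin r, f ⁻¹' Icc ((holeCentre r j).re + e j - w) ((holeCentre r j).re + e j + w) := by
      ext a; simp
    rw [this]
    exact isClosed_iUnion_of_finite fun j ↦ isClosed_Icc.preimage hfc.continuous
  have hf'A : ∀ θ ∈ A, deriv f θ ≠ 0 := by
    rintro θ ⟨-, j, hj⟩ h0
    exact hcrit j θ h0 hj
  -- the quotient `|angv| / |f'|` is continuous on `A`, hence bounded
  have hqc : ContinuousOn (fun θ ↦ |angv θ| / |deriv f θ|) A :=
    (hangvc.abs.continuousOn).div hf'c.abs.continuousOn fun θ hθ ↦ abs_ne_zero.2 (hf'A θ hθ)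
  obtain ⟨M₀, hM₀0, hM₀⟩ : ∃ M₀ : ℝ, 0 ≤ M₀ ∧ ∀ θ ∈ A, |angv θ| / |deriv f θ| ≤ M₀ := by
    rcases A.eq_empty_or_nonempty with hA0 | hAne
    · exact ⟨0, le_rfl, fun θ hθ ↦ by rw [hA0] at hθ; exact hθ.elim⟩
    · obtain ⟨θ₁, hθ₁, hmax⟩ := hAc.exists_isMaxOn hAne hqc
      exact ⟨|angv θ₁| / |deriv f θ₁|, by positivity, fun θ hθ ↦ hmax hθ⟩
  refine ⟨M₀, hM₀0, fun θ hθ ↦ ?_⟩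
  -- reduce `θ` into the period window
  obtain ⟨n, y, hy, hyθ⟩ := exists_mem_Icc_two_pi θ
  have hfy : f y = f θ := by rw [hyθ]; exact hfper.sub_zsmul_eq n
  have hf'y : deriv f y = deriv f θ := by rw [hyθ]; exact hf'per.sub_zsmul_eq n
  have hangvy : angv y = angv θ := by rw [hyθ]; exact hangvper.sub_zsmul_eq n
  have hyA : y ∈ A := ⟨hy, by rw [hfy]; exact hθ⟩
  have hθ0 : deriv f θ ≠ 0 := by rw [← hf'y]; exact hf'A y hyA
  have h := hM₀ y hyA
  rw [hangvy, hf'y, div_le_iff₀ (abs_pos.2 hθ0)] at h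
  exact h

/-! ## Upper and lower points at the same window radius are uniformly apart -/

/-- Closed-window version of the guard: a point of `M_r` with `|Re z - c_j - e_j| ≤ w` is off the
real axis. [folklore] -/
theorem im_ne_zero_of_re_mem_closedWindow {z : ℂ} {j : Fin r} (hz : (1 : ℝ) ≤ ‖z - holeCentre r j‖)
    {e w : ℝ} (hew : |e| + w < 1) (hre : |z.re - (holeCentre r j).re - e| ≤ w) : z.im ≠ 0 := by
  intro him
  have h1 : ‖z - holeCentre r j‖ = |z.re - (holeCentre r j).re| := by
    have hz' : z - holeCentre r j = ((z.re - (holeCentre r j).re : ℝ) : ℂ) := by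
      apply Complex.ext <;> simp [holeCentre, him]
    rw [hz', Complex.norm_real, Real.norm_eq_abs]
  have h2 : |z.re - (holeCentre r j).re| ≤ |z.re - (holeCentre r j).re - e| + |e| := by
    have := abs_add_le (z.re - (holeCentre r j).re - e) e
    simpa using this
  linarith

/-- **Upper and lower points of a band at the same radius are uniformly apart**: if the crossing
values of `D(0⃗)(K)` avoid the closed windows then `‖c s - c t‖ ≥ δ₀ > 0` whenever
`Re z(s) = Re z(t)` lies in a closed window, `s` is upper and `t` is lower.
[cite: ManolescuMarengonSarkarWillis2023, §8.1] -/
theorem exists_lowerBound_dist_upper_lower {K : 𝕊 1 → 𝔼 4} (hK : IsModelKnot r K)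
    {K₃ : Knot} (hK₃ : ⇑K₃ = finiteApprox r 0 K) {w : ℝ} {e : Fin r → ℝ}
    (he : ∀ j, |e j| + w < 1)
    (hcross : ∀ s t, K₃.planeCurve s = K₃.planeCurve t → circlePoint s ≠ circlePoint t →
      ∀ j : Fin r, (zC (K (circlePoint s))).re ∉
        Icc ((holeCentre r j).re + e j - w) ((holeCentre r j).re + e j + w)) :
    ∃ δ₀ : ℝ, 0 < δ₀ ∧ ∀ s t : ℝ, (∃ j : Fin r, (zC (K (circlePoint s))).re ∈
        Icc ((holeCentre r j).re + e j - w) ((holeCentre r j).re + e j + w)) →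
      (zC (K (circlePoint t))).re = (zC (K (circlePoint s))).re →
      0 < (zC (K (circlePoint s))).im → (zC (K (circlePoint t))).im < 0 →
      δ₀ ≤ ‖chartC (K₃.stereoCurve s) - chartC (K₃.stereoCurve t)‖ := by
  set f : ℝ → ℝ := fun θ ↦ (zC (K (circlePoint θ))).re with hf
  set g : ℝ → ℝ := fun θ ↦ (zC (K (circlePoint θ))).im with hg
  set c : ℝ → ℂ := fun θ ↦ chartC (K₃.stereoCurve θ) with hc
  have hne : ∀ x, K₃ x ≠ northPole := fun x ↦ ne_northPole_of_coe_eq_finiteApprox hK₃ x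
  have hfc : Continuous f := continuous_re_zC_comp hK
  have hgc : Continuous g := continuous_im_zC_comp hK
  have hcc : Continuous c := by
    have h := (Knot.contDiff_stereoCurve hne).continuous
    have hch : Continuous chartC := by unfold chartC; fun_prop
    exact hch.comp h
  have hfper : Periodic f (2 * Real.pi) := fun θ ↦ by simp only [hf, periodic_circlePoint θ]
  have hgper : Periodic g (2 * Real.pi) := fun θ ↦ by simp only [hg, periodic_circlePoint θ]
  have hcper : Periodic c (2 * Real.pi) := fun θ ↦ by simp only [hc, K₃.periodic_stereoCurve θ]
  -- the window predicate
  set Win : ℝ → Prop := fun θ ↦ ∃ j : Fin r,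
    f θ ∈ Icc ((holeCentre r j).re + e j - w) ((holeCentre r j).re + e j + w) with hWin
  have hWclosed : IsClosed {θ | Win θ} := by
    have : {θ | Win θ} = ⋃ j : Fin r,
        f ⁻¹' Icc ((holeCentre r j).re + e j - w) ((holeCentre r j).re + e j + w) := by
      ext θ; simp [hWin]
    rw [this]
    exact isClosed_iUnion_of_finite fun j ↦ isClosed_Icc.preimage hfc
  -- positivity of the distance at an upper/lower pair of a window
  have hpos : ∀ s t, Win s → f t = f s → 0 ≤ g s → g t ≤ 0 → 0 < ‖c s - c t‖ := by
    intro s t hs hts hgs hgt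
    obtain ⟨j, hj⟩ := hs
    have hjs : |f s - (holeCentre r j).re - e j| ≤ w := by
      rw [abs_le]; constructor <;> linarith [hj.1, hj.2]
    have hjt : |f t - (holeCentre r j).re - e j| ≤ w := by rw [hts]; exact hjs
    have hs0 : g s ≠ 0 :=
      im_ne_zero_of_re_mem_closedWindow (one_le_norm_zC_sub_holeCentre (hK.mem _).1 j) (he j) hjs
    have ht0 : g t ≠ 0 :=
      im_ne_zero_of_re_mem_closedWindow (one_le_norm_zC_sub_holeCentre (hK.mem _).1 j) (he j) hjt
    have hgs' : 0 < g s := lt_of_le_of_ne hgs hs0.symm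
    have hgt' : g t < 0 := lt_of_le_of_ne hgt ht0
    rw [norm_pos_iff, sub_ne_zero]
    intro hcst
    have hpc : K₃.planeCurve s = K₃.planeCurve t := planeCurve_eq_of_chartC_eq hcst
    by_cases hst : circlePoint s = circlePoint t
    · have : g s = g t := by simp only [hg, hst]
      linarith
    · exact hcross s t hpc hst j hj
  -- the compact set of such pairs in one period square
  set D : Set (ℝ × ℝ) := {p | p.1 ∈ Icc 0 (2 * Real.pi) ∧ p.2 ∈ Icc 0 (2 * Real.pi) ∧ Win p.1 ∧
    f p.2 = f p.1 ∧ 0 ≤ g p.1 ∧ g p.2 ≤ 0} with hD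
  have hDc : IsCompact D := by
    refine (isCompact_Icc.prod isCompact_Icc).of_isClosed_subset ?_ fun p hp ↦ ⟨hp.1, hp.2.1⟩
    simp only [hD, setOf_and]
    exact (isClosed_Icc.preimage continuous_fst).inter ((isClosed_Icc.preimage continuous_snd).inter
      ((hWclosed.preimage continuous_fst).inter ((isClosed_eq (hfc.comp continuous_snd)
        (hfc.comp continuous_fst)).inter ((isClosed_le continuous_const (hgc.comp continuous_fst)).inter
          (isClosed_le (hgc.comp continuous_snd) continuous_const)))))
  have hFc : Continuous fun p : ℝ × ℝ ↦ ‖c p.1 - c p.2‖ :=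
    ((hcc.comp continuous_fst).sub (hcc.comp continuous_snd)).norm
  obtain ⟨δ₀, hδ₀, hmin⟩ : ∃ δ₀ : ℝ, 0 < δ₀ ∧ ∀ p ∈ D, δ₀ ≤ ‖c p.1 - c p.2‖ := by
    rcases D.eq_empty_or_nonempty with hD0 | hDne
    · exact ⟨1, one_pos, fun p hp ↦ by rw [hD0] at hp; exact hp.elim⟩
    · obtain ⟨p₀, hp₀, hmin⟩ := hDc.exists_isMinOn hDne hFc.continuousOn
      exact ⟨‖c p₀.1 - c p₀.2‖, hpos _ _ hp₀.2.2.1 hp₀.2.2.2.1 hp₀.2.2.2.2.1 hp₀.2.2.2.2.2,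
        fun p hp ↦ hmin hp⟩
  refine ⟨δ₀, hδ₀, fun s t hs hts hgs hgt ↦ ?_⟩
  -- reduce both parameters into the period window
  obtain ⟨n₁, y₁, hy₁, hy₁s⟩ := exists_mem_Icc_two_pi s
  obtain ⟨n₂, y₂, hy₂, hy₂t⟩ := exists_mem_Icc_two_pi t
  have hf₁ : f y₁ = f s := by rw [hy₁s]; exact hfper.sub_zsmul_eq n₁
  have hf₂ : f y₂ = f t := by rw [hy₂t]; exact hfper.sub_zsmul_eq n₂
  have hg₁ : g y₁ = g s := by rw [hy₁s]; exact hgper.sub_zsmul_eq n₁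
  have hg₂ : g y₂ = g t := by rw [hy₂t]; exact hgper.sub_zsmul_eq n₂
  have hc₁ : c y₁ = c s := by rw [hy₁s]; exact hcper.sub_zsmul_eq n₁
  have hc₂ : c y₂ = c t := by rw [hy₂t]; exact hcper.sub_zsmul_eq n₂
  have hmem : (y₁, y₂) ∈ D := by
    refine ⟨hy₁, hy₂, ?_, ?_, ?_, ?_⟩
    · show Win y₁
      simp only [hWin, hf₁]; exact hs
    · show f y₂ = f y₁
      rw [hf₁, hf₂]; exact hts
    · show 0 ≤ g y₁
      rw [hg₁]; exact hgs.le
    · show g y₂ ≤ 0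
      rw [hg₂]; exact hgt.le
  have h := hmin _ hmem
  simp only [hc₁, hc₂] at h
  exact h

end MMSW

end Literature.Topology.FourManifolds

end
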